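import Summits.RiemannHypothesis.RiemannHypothesis.Theorems.WeilTwoPrimeDeflM80PDef
import Summits.RiemannHypothesis.RiemannHypothesis.Theorems.WeilTwoPrimeDeflM80PDataPE33
import Literature.NumberTheory.LFunctions.WeilBlockRowsR
import HarnessLib

/-!
# Even-sector deflated two-prime certificate M80P: the materialized even block agrees with `P_r + Σ μ ĉ ĉᵀ`, rows 40–49

`WeilCert.checkPmRowG` for certificate M80P (even block), by `decide +kernel`. Pure proof file; nothing is asserted.
-/

set_option linter.dupNamespace false

noncomputable section

namespace Summit.RiemannHypothesis.RiemannHypothesis.Theorems.EvenWinsBeyondArch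

open Literature.NumberTheory.LFunctions

set_option maxHeartbeats 0 in
/-- Row 40 of the materialized even block is row 40 of `P_r + Σ μ ĉ ĉᵀ` (certificate M80P). [folklore] -/
theorem checkPmRowG0_40_weilCertDeflM80P : weilCertDeflM80PBase.checkPmRowG weilCertDeflM80PP weilCertDeflM80PPmE 0 40 = true := by
  decide +kernel

set_option maxHeartbeats 0 in
/-- Row 41 of the materialized even block is row 41 of `P_r + Σ μ ĉ ĉᵀ` (certificate M80P). [folklore] -/
theorem checkPmRowG0_41_weilCertDeflM80P : weilCertDeflM80PBase.checkPmRowG weilCertDeflM80PP weilCertDeflM80PPmE 0 41 = true := by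
  decide +kernel

set_option maxHeartbeats 0 in
/-- Row 42 of the materialized even block is row 42 of `P_r + Σ μ ĉ ĉᵀ` (certificate M80P). [folklore] -/
theorem checkPmRowG0_42_weilCertDeflM80P : weilCertDeflM80PBase.checkPmRowG weilCertDeflM80PP weilCertDeflM80PPmE 0 42 = true := by
  decide +kernel

set_option maxHeartbeats 0 in
/-- Row 43 of the materialized even block is row 43 of `P_r + Σ μ ĉ ĉᵀ` (certificate M80P). [folklore] -/
theorem checkPmRowG0_43_weilCertDeflM80P : weilCertDeflM80PBase.checkPmRowG weilCertDeflM80PP weilCertDeflM80PPmE 0 43 = true := by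
  decide +kernel

set_option maxHeartbeats 0 in
/-- Row 44 of the materialized even block is row 44 of `P_r + Σ μ ĉ ĉᵀ` (certificate M80P). [folklore] -/
theorem checkPmRowG0_44_weilCertDeflM80P : weilCertDeflM80PBase.checkPmRowG weilCertDeflM80PP weilCertDeflM80PPmE 0 44 = true := by
  decide +kernel

set_option maxHeartbeats 0 in
/-- Row 45 of the materialized even block is row 45 of `P_r + Σ μ ĉ ĉᵀ` (certificate M80P). [folklore] -/
theorem checkPmRowG0_45_weilCertDeflM80P : weilCertDeflM80PBase.checkPmRowG weilCertDeflM80PP weilCertDeflM80PPmE 0 45 = true := by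
  decide +kernel

set_option maxHeartbeats 0 in
/-- Row 46 of the materialized even block is row 46 of `P_r + Σ μ ĉ ĉᵀ` (certificate M80P). [folklore] -/
theorem checkPmRowG0_46_weilCertDeflM80P : weilCertDeflM80PBase.checkPmRowG weilCertDeflM80PP weilCertDeflM80PPmE 0 46 = true := by
  decide +kernel

set_option maxHeartbeats 0 in
/-- Row 47 of the materialized even block is row 47 of `P_r + Σ μ ĉ ĉᵀ` (certificate M80P). [folklore] -/
theorem checkPmRowG0_47_weilCertDeflM80P : weilCertDeflM80PBase.checkPmRowG weilCertDeflM80PP weilCertDeflM80PPmE 0 47 = true := by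
  decide +kernel

set_option maxHeartbeats 0 in
/-- Row 48 of the materialized even block is row 48 of `P_r + Σ μ ĉ ĉᵀ` (certificate M80P). [folklore] -/
theorem checkPmRowG0_48_weilCertDeflM80P : weilCertDeflM80PBase.checkPmRowG weilCertDeflM80PP weilCertDeflM80PPmE 0 48 = true := by
  decide +kernel

set_option maxHeartbeats 0 in
/-- Row 49 of the materialized even block is row 49 of `P_r + Σ μ ĉ ĉᵀ` (certificate M80P). [folklore] -/
theorem checkPmRowG0_49_weilCertDeflM80P : weilCertDeflM80PBase.checkPmRowG weilCertDeflM80PP weilCertDeflM80PPmE 0 49 = true := by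
  decide +kernel


end Summit.RiemannHypothesis.RiemannHypothesis.Theorems.EvenWinsBeyondArch
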